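import Mathlib
import Literature.Analysis.Fourier.HilbertTransformLine
import HarnessLib

/-!
# The truncated Hilbert transform on the line: pointwise convergence, `L¹` and `L²` bounds

`Literature/Analysis/Fourier`. Companion of `HilbertTransformLine.lean` (the p.v. symmetric operator
`hilbertTransform f x = π⁻¹ ∫_{t>0} (f(x−t) − f(x+t))/t dt`). This file introduces the **truncated** operator

  `H_{ε,R} f (x) := π⁻¹ ∫_{ε<t<R} (f(x−t) − f(x+t))/t dt`      (`hilbertTransformTrunc ε R f x`)

(the kernel `1/(πt)` cut off to the window `ε < |t| < R`, folded onto `t > 0`) and proves the three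
elementary facts that every `L²` theory of the Hilbert transform starts from
[cite: Grafakos2014, Def. 5.1.1, eqs. (5.1.3)–(5.1.5) (truncated integrals `H^{(ε,N)}`) and Thm. 5.1.7 / eq. (5.1.21)
(`L²` theory via the Fourier multiplier)]:

* `tendsto_hilbertTransformTrunc` — if the symmetric integrand of `f` at `x` is integrable on `(0,∞)` then
  `H_{1/(n+1), n+1} f (x) → H f (x)` (monotone convergence of the windows `(1/(n+1), n+1) ↑ (0,∞)`);
* `integrable_hilbertTransformTrunc` — for `f ∈ L¹` and `ε > 0` the truncation is in `L¹` (Tonelli: the kernel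
  is integrable on the window);
* `memLp_two_hilbertTransformTrunc` — for `f ∈ L¹ ∩ L²` and `ε > 0` the truncation is in `L²` (Cauchy–Schwarz
  against the finite measure `dt/t` on the window, then Tonelli).

These feed the Fourier-multiplier computation (`HilbertTransformLineMultiplier.lean`) and the `L²` isometry
`‖Hf‖₂ = ‖f‖₂` (`HilbertTransformLineL2.lean`). MOTIVATION (cell ns-blowup, zone Z3, SHEET-ℝ certificate frame,
`HOME/selfsim/SHEET-R-FRAME-NOTE-v2.md` §1 (1a)): the isometry is the one frame identity flagged there as «not in
the tree as a theorem». WHAT THIS IS NOT: not Navier–Stokes; classical harmonic analysis. All statements [folklore]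
unless cited.
-/

namespace Literature.Analysis.Fourier

open _root_.MeasureTheory Set Filter
open scoped Real Topology ENNReal

/-! ### The truncated operator -/

/-- The **truncated symmetric Hilbert transform** `H_{ε,R} f (x) = π⁻¹ ∫_{ε<t<R} (f(x−t) − f(x+t))/t dt`
(the p.v. kernel restricted to `ε < |t| < R`, folded onto `t > 0`; same sign convention as `hilbertTransform`:
`H cos = sin`). It is the case `n = 1`, `Ω(±1) = ±1/π` of the doubly truncated singular integral `T_Ω^{(ε,N)}`.
[cite: Grafakos2014, Def. 5.1.1 eq. (5.1.3) and Def. 5.2.1 eq. (5.2.3)] -/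
noncomputable def hilbertTransformTrunc (ε R : ℝ) (f : ℝ → ℝ) (x : ℝ) : ℝ :=
  π⁻¹ * ∫ t in Ioo ε R, (f (x - t) - f (x + t)) / t

/-- The standard exhausting windows `(1/(n+1), n+1)`, `n : ℕ`, are increasing. [folklore] -/
private theorem monotone_Ioo_window :
    Monotone (fun n : ℕ => Ioo (1 / ((n : ℝ) + 1)) ((n : ℝ) + 1)) := by
  intro m n hmn
  have hmn' : (m : ℝ) + 1 ≤ (n : ℝ) + 1 := by exact_mod_cast Nat.succ_le_succ hmn
  apply Ioo_subset_Ioo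
  · exact one_div_le_one_div_of_le (by positivity) hmn'
  · exact hmn'

/-- The windows `(1/(n+1), n+1)` exhaust `(0, ∞)`. [folklore] -/
private theorem iUnion_Ioo_window :
    (⋃ n : ℕ, Ioo (1 / ((n : ℝ) + 1)) ((n : ℝ) + 1)) = Ioi 0 := by
  ext t
  simp only [mem_iUnion, mem_Ioo, mem_Ioi]
  constructor
  · rintro ⟨n, h1, _⟩
    exact lt_trans (by positivity) h1
  · intro ht
    obtain ⟨n, hn⟩ := exists_nat_gt (max t (1 / t))
    have hn' : max t (1 / t) < (n : ℝ) + 1 := hn.trans (lt_add_one _)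
    refine ⟨n, ?_, lt_of_le_of_lt (le_max_left _ _) hn'⟩
    have h1 : 1 / t < (n : ℝ) + 1 := lt_of_le_of_lt (le_max_right _ _) hn'
    rw [div_lt_iff₀ ht] at h1
    rw [div_lt_iff₀ (by positivity)]
    linarith

/-- **Pointwise convergence of the truncations.** If the symmetric integrand `(f(x−t) − f(x+t))/t` is
integrable on `(0, ∞)` at the point `x`, then `H_{1/(n+1), n+1} f (x) → H f (x)` («`T_Ω(f)(x) = lim_{ε→0, N→∞}
T_Ω^{(ε,N)}(f)(x)`»). [cite: Grafakos2014, Def. 5.2.1 (display after (5.2.3)) and eq. (5.1.4) with Rmk. 5.1.2] -/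
theorem tendsto_hilbertTransformTrunc {f : ℝ → ℝ} {x : ℝ}
    (hx : IntegrableOn (fun t => (f (x - t) - f (x + t)) / t) (Ioi 0)) :
    Tendsto (fun n : ℕ => hilbertTransformTrunc (1 / ((n : ℝ) + 1)) ((n : ℝ) + 1) f x) atTop
      (𝓝 (hilbertTransform f x)) := by
  unfold hilbertTransformTrunc hilbertTransform
  refine Tendsto.const_mul _ ?_
  have h := tendsto_setIntegral_of_monotone (μ := volume)
    (f := fun t => (f (x - t) - f (x + t)) / t) (fun n => measurableSet_Ioo) monotone_Ioo_window
    (by rw [iUnion_Ioo_window]; exact hx)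
  rw [iUnion_Ioo_window] at h
  exact h

/-! ### Integrability of the shifted kernels on `ℝ × (ε, R)` -/

/-- `(x,t) ↦ x − t` is quasi-measure-preserving from `volume × ν` to `volume` for every s-finite `ν`. [folklore] -/
private theorem quasiMeasurePreserving_sub_prod_restrict (ν : Measure ℝ) [SFinite ν] :
    Measure.QuasiMeasurePreserving (fun p : ℝ × ℝ => p.1 - p.2) ((volume : Measure ℝ).prod ν) volume := by
  have h := (measurePreserving_sub_prod (volume : Measure ℝ) ν).quasiMeasurePreserving
  exact (Measure.quasiMeasurePreserving_fst (μ := (volume : Measure ℝ)) (ν := ν)).comp h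

/-- `(x,t) ↦ x + t` is quasi-measure-preserving from `volume × ν` to `volume` for every s-finite `ν`. [folklore] -/
private theorem quasiMeasurePreserving_add_prod_restrict (ν : Measure ℝ) [SFinite ν] :
    Measure.QuasiMeasurePreserving (fun p : ℝ × ℝ => p.1 + p.2) ((volume : Measure ℝ).prod ν) volume := by
  have h := (measurePreserving_add_prod (volume : Measure ℝ) ν).quasiMeasurePreserving
  exact (Measure.quasiMeasurePreserving_fst (μ := (volume : Measure ℝ)) (ν := ν)).comp h

/-- Joint measurability of `(x,t) ↦ φ(x − t)/t`. [folklore] -/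
private theorem aestronglyMeasurable_comp_sub_div {φ : ℝ → ℝ} (hφ : AEStronglyMeasurable φ volume)
    (ν : Measure ℝ) [SFinite ν] :
    AEStronglyMeasurable (fun p : ℝ × ℝ => φ (p.1 - p.2) / p.2) ((volume : Measure ℝ).prod ν) := by
  have h1 : AEStronglyMeasurable (fun p : ℝ × ℝ => φ (p.1 - p.2)) ((volume : Measure ℝ).prod ν) :=
    hφ.comp_quasiMeasurePreserving (quasiMeasurePreserving_sub_prod_restrict ν)
  exact h1.mul (measurable_snd.inv).aestronglyMeasurable

/-- Joint measurability of `(x,t) ↦ φ(x + t)/t`. [folklore] -/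
private theorem aestronglyMeasurable_comp_add_div {φ : ℝ → ℝ} (hφ : AEStronglyMeasurable φ volume)
    (ν : Measure ℝ) [SFinite ν] :
    AEStronglyMeasurable (fun p : ℝ × ℝ => φ (p.1 + p.2) / p.2) ((volume : Measure ℝ).prod ν) := by
  have h1 : AEStronglyMeasurable (fun p : ℝ × ℝ => φ (p.1 + p.2)) ((volume : Measure ℝ).prod ν) :=
    hφ.comp_quasiMeasurePreserving (quasiMeasurePreserving_add_prod_restrict ν)
  exact h1.mul (measurable_snd.inv).aestronglyMeasurable

/-- On the window `(ε, R)`, `ε > 0`, the function `t ↦ C/|t|` is integrable. [folklore] -/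
private theorem integrableOn_const_div_abs {ε R : ℝ} (hε : 0 < ε) (C : ℝ) :
    IntegrableOn (fun t : ℝ => C / |t|) (Ioo ε R) := by
  have hfin : volume (Ioo ε R) < ∞ := measure_Ioo_lt_top
  refine Integrable.mono' (g := fun _ => |C| / ε) ((integrableOn_const_iff).2 (Or.inr hfin)) ?_ ?_
  · exact ((measurable_const.div measurable_abs).aestronglyMeasurable).restrict
      |>.congr (ae_of_all _ fun _ => rfl)
  · rw [ae_restrict_iff' measurableSet_Ioo]
    refine ae_of_all _ fun t ht => ?_
    have ht0 : 0 < t := hε.trans ht.1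
    rw [Real.norm_eq_abs, abs_div, abs_abs, abs_of_pos ht0]
    exact div_le_div_of_nonneg_left (abs_nonneg _) hε ht.1.le

/-- For `φ ∈ L¹(ℝ)` and `ε > 0`, `(x,t) ↦ φ(x − t)/t` is integrable on `ℝ × (ε, R)`. [folklore] -/
private theorem integrable_prod_comp_sub_div {φ : ℝ → ℝ} (hφ : Integrable φ) {ε R : ℝ} (hε : 0 < ε) :
    Integrable (fun p : ℝ × ℝ => φ (p.1 - p.2) / p.2)
      ((volume : Measure ℝ).prod (volume.restrict (Ioo ε R))) := by
  rw [integrable_prod_iff' (aestronglyMeasurable_comp_sub_div hφ.aestronglyMeasurable _)]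
  refine ⟨ae_of_all _ fun t => (hφ.comp_sub_right t).div_const t, ?_⟩
  have heq : (fun t : ℝ => ∫ x, ‖φ (x - t) / t‖) = fun t => (∫ x, ‖φ x‖) / |t| := by
    funext t
    have h1 : (fun x => ‖φ (x - t) / t‖) = fun x => ‖φ (x - t)‖ * |t|⁻¹ := by
      funext x; rw [norm_div, Real.norm_eq_abs t, div_eq_mul_inv]
    rw [h1, integral_mul_const, integral_sub_right_eq_self (fun x => ‖φ x‖) t, div_eq_mul_inv]
  rw [heq]
  exact integrableOn_const_div_abs hε _

/-- For `φ ∈ L¹(ℝ)` and `ε > 0`, `(x,t) ↦ φ(x + t)/t` is integrable on `ℝ × (ε, R)`. [folklore] -/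
private theorem integrable_prod_comp_add_div {φ : ℝ → ℝ} (hφ : Integrable φ) {ε R : ℝ} (hε : 0 < ε) :
    Integrable (fun p : ℝ × ℝ => φ (p.1 + p.2) / p.2)
      ((volume : Measure ℝ).prod (volume.restrict (Ioo ε R))) := by
  rw [integrable_prod_iff' (aestronglyMeasurable_comp_add_div hφ.aestronglyMeasurable _)]
  refine ⟨ae_of_all _ fun t => (hφ.comp_add_right t).div_const t, ?_⟩
  have heq : (fun t : ℝ => ∫ x, ‖φ (x + t) / t‖) = fun t => (∫ x, ‖φ x‖) / |t| := by
    funext t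
    have h1 : (fun x => ‖φ (x + t) / t‖) = fun x => ‖φ (x + t)‖ * |t|⁻¹ := by
      funext x; rw [norm_div, Real.norm_eq_abs t, div_eq_mul_inv]
    rw [h1, integral_mul_const, integral_add_right_eq_self (fun x => ‖φ x‖) t, div_eq_mul_inv]
  rw [heq]
  exact integrableOn_const_div_abs hε _

/-- For `f ∈ L¹(ℝ)` and `ε > 0`, the truncated symmetric integrand `(x,t) ↦ (f(x−t) − f(x+t))/t` is integrable on
`ℝ × (ε, R)` (absolute convergence of the doubly truncated singular integral against an `L¹` function: the truncated kernel
is integrable, Tonelli). [cite: Grafakos2014, Def. 5.2.1, remark after eq. (5.2.3) («(5.2.3) is finite a.e. and therefore well defined»)] -/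
theorem integrable_prod_symmIntegrand {f : ℝ → ℝ} (hf : Integrable f) {ε R : ℝ} (hε : 0 < ε) :
    Integrable (fun p : ℝ × ℝ => (f (p.1 - p.2) - f (p.1 + p.2)) / p.2)
      ((volume : Measure ℝ).prod (volume.restrict (Ioo ε R))) := by
  refine ((integrable_prod_comp_sub_div hf hε (R := R)).sub (integrable_prod_comp_add_div hf hε)).congr ?_
  exact ae_of_all _ fun p => (sub_div _ _ _).symm

/-! ### `L¹` -/

/-- **The truncated Hilbert transform of an `L¹` function is in `L¹`** (`ε > 0`) — the case `p = 1`, `n = 1` of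
`‖T_Ω^{(ε,N)} f‖_{L^p} ≤ ‖Ω‖_{L¹} log(N/ε) ‖f‖_{L^p}`. [cite: Grafakos2014, Def. 5.2.1, display after eq. (5.2.3)] -/
theorem integrable_hilbertTransformTrunc {f : ℝ → ℝ} (hf : Integrable f) {ε R : ℝ} (hε : 0 < ε) :
    Integrable (hilbertTransformTrunc ε R f) := by
  unfold hilbertTransformTrunc
  exact ((integrable_prod_symmIntegrand hf hε (R := R)).integral_prod_left).const_mul _

/-! ### `L²` -/

/-- Cauchy–Schwarz against a weight, `∫⁻` form: `(∫ u·w)² ≤ (∫ w)·(∫ u²·w)`. [folklore] -/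
private theorem lintegral_mul_sq_le {α : Type*} [MeasurableSpace α] (μ : Measure α) {u w : α → ℝ≥0∞}
    (hu : AEMeasurable u μ) (hw : AEMeasurable w μ) :
    (∫⁻ a, u a * w a ∂μ) ^ 2 ≤ (∫⁻ a, w a ∂μ) * ∫⁻ a, u a ^ 2 * w a ∂μ := by
  -- `u w = (u w^{1/2}) · w^{1/2}` and Hölder with `p = q = 2`
  have hsplit : ∀ a, u a * w a = (u a * w a ^ (1 / 2 : ℝ)) * w a ^ (1 / 2 : ℝ) := by
    intro a
    rw [mul_assoc, ← ENNReal.rpow_add_of_nonneg _ _ (by norm_num) (by norm_num)]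
    norm_num
  have h1 : AEMeasurable (fun a => u a * w a ^ (1 / 2 : ℝ)) μ := hu.mul (hw.pow_const _)
  have h2 : AEMeasurable (fun a => w a ^ (1 / 2 : ℝ)) μ := hw.pow_const _
  have hH := ENNReal.lintegral_mul_le_Lp_mul_Lq μ Real.HolderConjugate.two_two h1 h2
  simp only [Pi.mul_apply] at hH
  have hA : ∀ a, (u a * w a ^ (1 / 2 : ℝ)) ^ (2 : ℝ) = u a ^ 2 * w a := by
    intro a
    rw [ENNReal.mul_rpow_of_nonneg _ _ (by norm_num), ← ENNReal.rpow_mul]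
    norm_num [ENNReal.rpow_two]
  have hB : ∀ a, (w a ^ (1 / 2 : ℝ)) ^ (2 : ℝ) = w a := by
    intro a
    rw [← ENNReal.rpow_mul]
    norm_num
  simp only [hA, hB] at hH
  calc (∫⁻ a, u a * w a ∂μ) ^ 2
      = (∫⁻ a, (u a * w a ^ (1 / 2 : ℝ)) * w a ^ (1 / 2 : ℝ) ∂μ) ^ 2 := by simp_rw [← hsplit]
    _ ≤ ((∫⁻ a, u a ^ 2 * w a ∂μ) ^ (1 / (2 : ℝ)) * (∫⁻ a, w a ∂μ) ^ (1 / (2 : ℝ))) ^ 2 := by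
        gcongr
    _ = (∫⁻ a, w a ∂μ) * ∫⁻ a, u a ^ 2 * w a ∂μ := by
        rw [mul_pow, ← ENNReal.rpow_two, ← ENNReal.rpow_two, ← ENNReal.rpow_mul, ← ENNReal.rpow_mul]
        norm_num
        rw [mul_comm]

/-- The weight `‖t⁻¹‖ₑ` has finite mass on the window `(ε, R)`, `ε > 0`: `∫_{(ε,R)} ‖t⁻¹‖ₑ ≤ ‖ε⁻¹‖ₑ·|(ε,R)| < ∞`.
[folklore] -/
private theorem lintegral_window_enorm_inv_lt_top {ε R : ℝ} (hε : 0 < ε) :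
    (∫⁻ t in Ioo ε R, ‖t⁻¹‖ₑ) < ∞ := by
  have hle : (∫⁻ t in Ioo ε R, ‖t⁻¹‖ₑ) ≤ ∫⁻ _ in Ioo ε R, ‖ε⁻¹‖ₑ := by
    refine setLIntegral_mono_ae' measurableSet_Ioo (ae_of_all _ fun t ht => ?_) |>.trans le_rfl
    have ht0 : 0 < t := hε.trans ht.1
    rw [Real.enorm_eq_ofReal (inv_nonneg.2 ht0.le), Real.enorm_eq_ofReal (inv_nonneg.2 hε.le)]
    exact ENNReal.ofReal_le_ofReal (inv_anti₀ hε ht.1.le)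
  refine lt_of_le_of_lt hle ?_
  rw [setLIntegral_const]
  exact ENNReal.mul_lt_top ENNReal.coe_lt_top measure_Ioo_lt_top

/-- **Core `L²` estimate.** Let `G : ℝ × ℝ → ℝ` be jointly a.e.-strongly measurable on `ℝ × (ε,R)` (`ε > 0`) with
`x`-sections of constant `L²` mass: `∫ ‖G(x,t)‖ₑ² dx = M` for `t ∈ (ε,R)`. Then
`∫ ‖∫_{(ε,R)} G(x,t)/t dt‖ₑ² dx ≤ L² · M` with `L = ∫_{(ε,R)} ‖t⁻¹‖ₑ` (Cauchy–Schwarz against `dt/t`, then Tonelli).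
[folklore] -/
private theorem lintegral_sq_integral_div_le {G : ℝ × ℝ → ℝ} {ε R : ℝ} (hε : 0 < ε) {M : ℝ≥0∞}
    (hG : AEStronglyMeasurable G ((volume : Measure ℝ).prod (volume.restrict (Ioo ε R))))
    (hM : ∀ t ∈ Ioo ε R, (∫⁻ x, ‖G (x, t)‖ₑ ^ 2) = M) :
    (∫⁻ x, ‖∫ t in Ioo ε R, G (x, t) / t‖ₑ ^ 2) ≤
      (∫⁻ t in Ioo ε R, ‖t⁻¹‖ₑ) ^ 2 * M := by
  set ν : Measure ℝ := volume.restrict (Ioo ε R) with hν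
  set L : ℝ≥0∞ := ∫⁻ t in Ioo ε R, ‖t⁻¹‖ₑ with hL
  have hGe : AEMeasurable (fun p : ℝ × ℝ => ‖G p‖ₑ) ((volume : Measure ℝ).prod ν) := hG.enorm
  have hw : AEMeasurable (fun p : ℝ × ℝ => ‖(p.2)⁻¹‖ₑ) ((volume : Measure ℝ).prod ν) :=
    (measurable_snd.inv.enorm).aemeasurable
  -- pointwise: `‖∫ G/t‖ₑ ≤ ∫⁻ ‖G‖ₑ ‖t⁻¹‖ₑ`, then Cauchy–Schwarz
  have hpt : ∀ x, AEMeasurable (fun t => ‖G (x, t)‖ₑ) ν →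
      ‖∫ t in Ioo ε R, G (x, t) / t‖ₑ ^ 2 ≤ L * ∫⁻ t in Ioo ε R, ‖G (x, t)‖ₑ ^ 2 * ‖t⁻¹‖ₑ := by
    intro x hx
    have h1 : ‖∫ t in Ioo ε R, G (x, t) / t‖ₑ ≤ ∫⁻ t in Ioo ε R, ‖G (x, t)‖ₑ * ‖t⁻¹‖ₑ := by
      refine (enorm_integral_le_lintegral_enorm _).trans (le_of_eq ?_)
      refine lintegral_congr fun t => ?_
      rw [div_eq_mul_inv, enorm_mul]
    calc ‖∫ t in Ioo ε R, G (x, t) / t‖ₑ ^ 2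
        ≤ (∫⁻ t in Ioo ε R, ‖G (x, t)‖ₑ * ‖t⁻¹‖ₑ) ^ 2 := by gcongr
      _ ≤ L * ∫⁻ t in Ioo ε R, ‖G (x, t)‖ₑ ^ 2 * ‖t⁻¹‖ₑ :=
          lintegral_mul_sq_le ν hx (measurable_inv.enorm.aemeasurable)
  -- a.e. in `x` the section is measurable
  have hsec : ∀ᵐ x ∂(volume : Measure ℝ), AEMeasurable (fun t => ‖G (x, t)‖ₑ) ν := by
    filter_upwards [hG.prodMk_left] with x hx using hx.enorm
  have hLtop : L ≠ ∞ := (lintegral_window_enorm_inv_lt_top hε (R := R)).ne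
  calc (∫⁻ x, ‖∫ t in Ioo ε R, G (x, t) / t‖ₑ ^ 2)
      ≤ ∫⁻ x, L * ∫⁻ t in Ioo ε R, ‖G (x, t)‖ₑ ^ 2 * ‖t⁻¹‖ₑ := by
        refine lintegral_mono_ae ?_
        filter_upwards [hsec] with x hx
        exact hpt x hx
    _ = L * ∫⁻ x, ∫⁻ t in Ioo ε R, ‖G (x, t)‖ₑ ^ 2 * ‖t⁻¹‖ₑ := by
        rw [lintegral_const_mul' _ _ hLtop]
    _ = L * ∫⁻ t in Ioo ε R, ∫⁻ x, ‖G (x, t)‖ₑ ^ 2 * ‖t⁻¹‖ₑ := by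
        rw [lintegral_lintegral_swap ((hGe.pow_const 2).mul hw)]
    _ = L * ∫⁻ t in Ioo ε R, M * ‖t⁻¹‖ₑ := by
        congr 1
        refine setLIntegral_congr_fun measurableSet_Ioo (fun t ht => ?_)
        rw [lintegral_mul_const' _ _ enorm_ne_top, hM t ht]
    _ = L ^ 2 * M := by
        rw [lintegral_const_mul _ measurable_inv.enorm, sq]
        ring

/-- **The truncated Hilbert transform of an `L¹ ∩ L²` function is in `L²`** (`ε > 0`) — the case `p = 2`, `n = 1` of
`‖T_Ω^{(ε,N)} f‖_{L^p} ≤ ‖Ω‖_{L¹} log(N/ε) ‖f‖_{L^p}` (here via Cauchy–Schwarz against `dt/t` and Tonelli, for `f ∈ L¹ ∩ L²`).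
[cite: Grafakos2014, Def. 5.2.1, display after eq. (5.2.3)] -/
theorem memLp_two_hilbertTransformTrunc {f : ℝ → ℝ} (hf : Integrable f) (hf2 : MemLp f 2) {ε R : ℝ}
    (hε : 0 < ε) : MemLp (hilbertTransformTrunc ε R f) 2 := by
  set ν : Measure ℝ := volume.restrict (Ioo ε R) with hν
  set L : ℝ≥0∞ := ∫⁻ t in Ioo ε R, ‖t⁻¹‖ₑ with hL
  set M : ℝ≥0∞ := ∫⁻ x, ‖f x‖ₑ ^ 2 with hMdef
  have hMtop : M < ∞ := by
    have h := lintegral_rpow_enorm_lt_top_of_eLpNorm_lt_top two_ne_zero ENNReal.ofNat_ne_top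
      hf2.eLpNorm_lt_top
    simpa [ENNReal.rpow_two] using h
  -- the two one-sided pieces `g₋(x) = ∫ f(x−t)/t`, `g₊(x) = ∫ f(x+t)/t`
  have hGm := aestronglyMeasurable_comp_sub_div hf.aestronglyMeasurable ν
  have hGp := aestronglyMeasurable_comp_add_div hf.aestronglyMeasurable ν
  have hSm : AEStronglyMeasurable (fun p : ℝ × ℝ => f (p.1 - p.2)) ((volume : Measure ℝ).prod ν) :=
    hf.aestronglyMeasurable.comp_quasiMeasurePreserving (quasiMeasurePreserving_sub_prod_restrict ν)
  have hSp : AEStronglyMeasurable (fun p : ℝ × ℝ => f (p.1 + p.2)) ((volume : Measure ℝ).prod ν) :=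
    hf.aestronglyMeasurable.comp_quasiMeasurePreserving (quasiMeasurePreserving_add_prod_restrict ν)
  have hbm := lintegral_sq_integral_div_le (G := fun p : ℝ × ℝ => f (p.1 - p.2)) (R := R) hε (M := M) hSm
    (fun t _ => lintegral_sub_right_eq_self (fun x => ‖f x‖ₑ ^ 2) t)
  have hbp := lintegral_sq_integral_div_le (G := fun p : ℝ × ℝ => f (p.1 + p.2)) (R := R) hε (M := M) hSp
    (fun t _ => lintegral_add_right_eq_self (fun x => ‖f x‖ₑ ^ 2) t)
  have hLtop : L < ∞ := lintegral_window_enorm_inv_lt_top hε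
  -- measurability of the pieces (sections of integrable kernels)
  have him : AEStronglyMeasurable (fun x => ∫ t in Ioo ε R, f (x - t) / t) volume :=
    (integrable_prod_comp_sub_div hf hε (R := R)).integral_prod_left.aestronglyMeasurable
  have hip : AEStronglyMeasurable (fun x => ∫ t in Ioo ε R, f (x + t) / t) volume :=
    (integrable_prod_comp_add_div hf hε (R := R)).integral_prod_left.aestronglyMeasurable
  have hmem : ∀ {g : ℝ → ℝ}, AEStronglyMeasurable g volume → (∫⁻ x, ‖g x‖ₑ ^ 2) ≤ L ^ 2 * M →
      MemLp g 2 := by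
    intro g hg hb
    refine ⟨hg, ?_⟩
    rw [eLpNorm_eq_lintegral_rpow_enorm_toReal two_ne_zero ENNReal.ofNat_ne_top]
    simp only [ENNReal.toReal_ofNat, one_div, ENNReal.rpow_two]
    refine ENNReal.rpow_lt_top_of_nonneg (by norm_num) (lt_of_le_of_lt hb ?_).ne
    exact ENNReal.mul_lt_top (ENNReal.pow_lt_top hLtop) hMtop
  have hMm : MemLp (fun x => ∫ t in Ioo ε R, f (x - t) / t) 2 := hmem him hbm
  have hMp : MemLp (fun x => ∫ t in Ioo ε R, f (x + t) / t) 2 := hmem hip hbp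
  -- `H_{ε,R} f = π⁻¹ (g₋ − g₊)` almost everywhere (where both `t`-integrals converge)
  have hae : hilbertTransformTrunc ε R f =ᵐ[volume]
      fun x => π⁻¹ * ((∫ t in Ioo ε R, f (x - t) / t) - ∫ t in Ioo ε R, f (x + t) / t) := by
    filter_upwards [(integrable_prod_comp_sub_div hf hε (R := R)).prod_right_ae,
      (integrable_prod_comp_add_div hf hε (R := R)).prod_right_ae] with x hxm hxp
    unfold hilbertTransformTrunc
    congr 1
    rw [← integral_sub hxm hxp]
    refine integral_congr_ae (ae_of_all _ fun t => ?_)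
    exact sub_div _ _ _
  exact (((hMm.sub hMp).const_mul π⁻¹)).ae_eq hae.symm

end Literature.Analysis.Fourier
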